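import Summits.QuantumFields.BalabanUV.Beta.GAN24.BornBorderLiftChain
import Summits.QuantumFields.BalabanUV.Beta.GAN24.BornBorderLiftAn1
import Summits.QuantumFields.BalabanUV.Beta.GAN24.BornBorderTent
import Summits.QuantumFields.BalabanUV.Beta.GAN24.Push3Nest
import Summits.QuantumFields.BalabanUV.Beta.GAN24.RespStepBmDecompPsi
import Summits.QuantumFields.BalabanUV.Beta.GAN24.ScaleNesting
import Summits.QuantumFields.BalabanUV.Beta.GAN24.ContactBorderCommutator

/-!
# The undressed V lineages ON an1's SYMMETRISED border as road S3's rooted pushed border row — the tent pair identification (twin of the OWNER's `BornBorderLiftChain`; its leg plumbing BY NAME)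

NOT IN PRINT — OUR BOOKKEEPING (road-P2 = `b2b-balaban-gan24-p2` gen 56, 2026-08-25; row G-an2-4 ∕ (CONV-C), the (α-0) chain at row D1's literal
OF RECORD (III′) `JsB12CombShSym`; [folklore] composition BY NAME; 0 `def`, 0 cite, 0 `def … : Prop`, 0 `sorry`).  Weight 0.  NEVER «G-an2-4 closed» as (CONV-C);
NOT D1, NOT BetaPertH, NOT continuum, NOT Clay; NO campaign opened (an2 W-4) — a brick of the located `hUv⁰` transfer (road-P2 MEMO M-gan24p2-g56-1 §2(b), M.77's RAW socket).

NAMING: «An1» = an1's (0.4)-SYMMETRISED border table `symVhSAt ρ` (the record field `SymTables.V`); the (E) files' «Sym» = the un-negated rooted `vhSAt ρ`.  METHOD = the OWNER's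
`mkroot.py` rule (road-P2's `tools/mkstab.py`): the (E) file VERBATIM with `vhSAt (toSite r) ↦ symVhSAt (toSite r)` through `TaylorMassVHAn1At ∕ …SymAn1At` (road-P2, this gen);
the table-FREE lemmas of the (E) file are NOT re-declared but opened BY NAME from it; same theorem names in the `…An1` namespace; (E) files untouched.
Discharges NOTHING of (hS, hSall) ∕ hB by itself — it prices the RAW undressed V letter of M.77 (one of the four ROW letters of the (III′) born row, V half).
-/

noncomputable section

open Finset
open scoped BigOperators
open Literature.MathematicalPhysics.QuantumFieldTheory
open Literature.MathematicalPhysics.QuantumFieldTheory.Balaban1983to89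
open Literature.MathematicalPhysics.QuantumFieldTheory.Balaban1983to89.Beta
open ExpKernelCalculus (MKer Decays BiLoc)
open OneStepResolventKernel (Fib LocStencil KInv decays_KInv)
open OneStepKernelFamily (dec colH decays_dec)
open BalabanStepJets (locStencil_mono)
open AffineAveraging (box toSite)
open Summit.QuantumFields.BalabanUV.Beta.SymAveragingHessianCounts (symVhSAt symVhKerAt symVhKerAt_eq_zero_left symVhKerAt_eq_zero_right abs_symVhKerAt_le
  locStencil_symVhSAt symVhSAt_symm)
open Summit.QuantumFields.BalabanUV.Beta.GAN24.CombesThomas (smStep KStepUnit)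
open BalabanCompositeJets (respStep pushSum pushSum_inl_inl biLoc_pushSum)
open DecLiftAdjoint (borderSum avgLift_smul)
open InterLevelTransport (avgLift)
open Summit.QuantumFields.BalabanUV.Beta.GAN24.Push4 (legComp IsFF)
open Summit.QuantumFields.BalabanUV.Beta.GAN24.Push4Bounds (LegDecay legDecay_colH)
open Summit.QuantumFields.BalabanUV.Beta.GAN24.Push3 (push₃ push₃_smul push₃_neg push₃_add locStencil_push₃_mono)
open Summit.QuantumFields.BalabanUV.Beta.GAN24.Push3Nest (push₃_push₃)
open Summit.QuantumFields.BalabanUV.Beta.GAN24.Push3LegTelescope (push₃_smul_left push₃_smul_right push₃_neg_left)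
open Summit.QuantumFields.BalabanUV.Beta.GAN24.E3UnitSplit (e3OfS)
open Summit.QuantumFields.BalabanUV.Beta.GAN24.SrecLinearPartEq (colM rowMM reslot legDecay_colM legDecay_rowMM locStencil_reslot)
open Summit.QuantumFields.BalabanUV.Beta.GAN24.RespStepSemigroup (legComp_respStep legComp_neg_left)
open Summit.QuantumFields.BalabanUV.Beta.GAN24.RespStepBmDecompPsi (legComp_smul_left legDecay_respStep_of_decays decays_KStepUnit_levels)
open Summit.QuantumFields.BalabanUV.Beta.GAN24.ScaleNesting (pushSum_avgLift)
open Summit.QuantumFields.BalabanUV.Beta.GAN24.PushSumNest (pushSum_finset_sum pushSum_smul)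
open Summit.QuantumFields.BalabanUV.Beta.GAN24.BornLambdaLift (colH_dec_KInv)
open Summit.QuantumFields.BalabanUV.Beta.GAN24.BornLambdaUndressedRow (e3OfS_smul)
open Summit.QuantumFields.BalabanUV.Beta.GAN24.BornBorderLift (mixed_push₃_eq_e3OfS_borderSum colM_KStepUnit rowMM_KStepUnit)
open Summit.QuantumFields.BalabanUV.Beta.GAN24.ContactBorderCommutator (reslot_smul)
open Summit.QuantumFields.BalabanUV.Beta.GAN24.BornBorderTent (tentLeg legComp_colM_dec_respStep legComp_rowMM_dec_respStep push₃_colM_pushSum push₃_rowMM_pushSum)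

open Summit.QuantumFields.BalabanUV.Beta.GAN24.BornBorderLiftChain (legDecay_neg legDecay_smul legDecay_mono exists_legDecay_respStep lineage_fm_eq_push₃ lineage_mf_eq_push₃ borderSum_smul pushSum_borderSum locStencil_pushSum pushSum_inr_inr_eq_zero_of)

open Summit.QuantumFields.BalabanUV.Beta.GAN24.TaylorMassVHAn1At (symBorderIncAt symVhSAt_inl_inl symVhSAt_inr_inr)

namespace Summit.QuantumFields.BalabanUV.Beta.GAN24.BornBorderLiftChainAn1

variable {d : ℕ}

/-! ## §1 Leg plumbing: localisation of the legs that occur -/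

section Legs

variable {r : Fin (d + 1) → (Fin (d + 1) → ℤ) → Fin (d + 1) → (Fin (d + 1) → ℤ) → ℝ} {N : ℕ} {C m : ℝ}





end Legs

/-! ## §2 The comb side: the undressed V lineage as ONE tent pair -/

section Comb

variable {Lc : ℕ} [NeZero Lc]

variable {R N : ℕ} [NeZero R] [NeZero N]

/-- NOT IN PRINT; OUR BOOKKEEPING ([folklore]).  **THE UNDRESSED V LINEAGE AS ONE TENT PAIR** (in-block root `ρ = toSite rr`): for `N = Lc^(i+1)·R`,
`push₃ B′ B′ B′ Y⁰_i = (cVH·(smStep d Lc i)²) • (push₃ B (tentLeg Lc R N) B (reslot inl inr (vhSAt ρ)) − push₃ (tentLeg Lc R N) B B (reslot inr inl (vhSAt ρ)))`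
(§2's two channels + `Push3.push₃_neg ∕ push₃_add` on the local inner pushes + trilinearity; leaf-02's `ContactBorderCommutator.reslot_smul`). -/
theorem lineage_v_eq_tent_pair (hLc : 1 ≤ Lc) {rr : Fin (d + 1) → ℕ} (hrr : rr ∈ box (d + 1) Lc) (cVH : ℝ) (i : ℕ) (hN : N = Lc ^ (i + 1) * R)
    (κ' : Fin (d + 1)) (u' : Fin (d + 1) → ℤ) :
    push₃ (respStep (d := d) (Lc ^ (i + 1)) N) (respStep (d := d) (Lc ^ (i + 1)) N) (respStep (d := d) (Lc ^ (i + 1)) N)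
        (fun κ u => -(push₃ (-respStep (d := d) (Lc ^ i) (Lc ^ (i + 1))) (colM (KStepUnit (d := d) Lc i) Lc)
              (respStep (d := d) (Lc ^ i) (Lc ^ (i + 1))) (reslot Sum.inl Sum.inr fun κ u => cVH • symVhSAt (toSite rr) d Lc rfl κ u) κ u
          + push₃ (rowMM (KStepUnit (d := d) Lc i) Lc) (respStep (d := d) (Lc ^ i) (Lc ^ (i + 1)))
              (respStep (d := d) (Lc ^ i) (Lc ^ (i + 1))) (reslot Sum.inr Sum.inl fun κ u => cVH • symVhSAt (toSite rr) d Lc rfl κ u) κ u)) κ' u'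
      = (cVH * (smStep d Lc i) ^ 2) •
          (push₃ (respStep (d := d) (Lc ^ i) N) (tentLeg Lc R N) (respStep (d := d) (Lc ^ i) N)
              (reslot Sum.inl Sum.inr fun κ u => symVhSAt (toSite rr) d Lc rfl κ u) κ' u'
            - push₃ (tentLeg Lc R N) (respStep (d := d) (Lc ^ i) N) (respStep (d := d) (Lc ^ i) N)
              (reslot Sum.inr Sum.inl fun κ u => symVhSAt (toSite rr) d Lc rfl κ u) κ' u') := by
  -- the border table and its two mixed reslots are local at rate 1
  have hV : LocStencil (fun κ u => cVH • symVhSAt (toSite rr) d Lc rfl κ u)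
      (|cVH| * (3 * (AveragingHessianKernels.ell (d + 1) Lc : ℝ) ^ 2 * Real.exp (4 * ((d : ℝ) + 1) * Lc * 1))) 1 :=
    StepJetData.locStencil_smul cVH (locStencil_symVhSAt hLc hrr zero_le_one)
  have hPfm := locStencil_reslot hV Sum.inl Sum.inr
  have hPmf := locStencil_reslot hV Sum.inr Sum.inl
  -- the inner pushes are local (common legs data at blocking `Lc`), so the outer push is additive on them
  obtain ⟨CK, mK, hmK, hK⟩ := decays_KStepUnit_levels (d := d) (Lc := Lc) i
  obtain ⟨C', m', hm', hB'⟩ := exists_legDecay_respStep (d := d) hN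
  have hR0 := legDecay_respStep_of_decays hK
  have hCs := (hV 0 0).nonneg (Sum.inl 0)
  obtain ⟨δ₁, hδ₁, hδ₁1, h2δ₁⟩ : ∃ δ₁ : ℝ, 0 < δ₁ ∧ δ₁ ≤ 1 ∧ 2 * δ₁ < mK :=
    ⟨min 1 (mK / 4), lt_min one_pos (by linarith), min_le_left _ _, by linarith [min_le_right (1 : ℝ) (mK / 4)]⟩
  have hA := locStencil_push₃_mono hLc (legDecay_neg hR0) (legDecay_colM (N := Lc) hK) hR0
    (locStencil_mono hPfm hCs hδ₁1) hδ₁.le h2δ₁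
  have hBm := locStencil_push₃_mono hLc (legDecay_rowMM (N := Lc) hK) hR0 hR0 (locStencil_mono hPmf hCs hδ₁1) hδ₁.le h2δ₁
  rw [push₃_neg, push₃_add hB' hB' hB' hm' hA hBm hδ₁ hδ₁ κ' u',
    lineage_fm_eq_push₃ hPfm one_pos i hN κ' u', lineage_mf_eq_push₃ hPmf one_pos i hN κ' u',
    reslot_smul, reslot_smul, push₃_smul, push₃_smul, push₃_neg_left, push₃_smul_right, push₃_smul_left]
  funext x z a b
  simp only [Pi.smul_apply, Pi.neg_apply, Pi.add_apply, Pi.sub_apply, smul_eq_mul]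
  ring

end Comb

/-! ## §3 Road S3's side: the rooted pushed border row as the same tent pair -/

section Road

variable {Lc : ℕ} [NeZero Lc] {R N : ℕ} [NeZero R] [NeZero N]





/-- NOT IN PRINT; OUR BOOKKEEPING ([folklore]).  **ROAD S3's ROOTED PUSHED BORDER ROW AS THE TENT PAIR**: for `N = Lc^(i+1)·R` (in-block root `ρ = toSite rr`),
`e3OfS N (pushSum (Lc^(i+1)) R ∘ borderSum (Lc^i) (vhSAt ρ)) = ((Lc^i)^{d+2})⁻¹ • (push₃ B (tentLeg Lc R N) B (reslot inl inr (vhSAt ρ)) − push₃ (tentLeg Lc R N) B B (reslot inr inl (vhSAt ρ)))`,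
`B = respStep (Lc^i) N` (`pushSum_borderSum`, PART 1's `mixed_push₃_eq_e3OfS_borderSum` on the pushed table, PART 2a's `push₃_colM_pushSum` ∕ `push₃_rowMM_pushSum`). -/
theorem road_v_eq_tent_pair (hLc : 1 ≤ Lc) {rr : Fin (d + 1) → ℕ} (hrr : rr ∈ box (d + 1) Lc) (i : ℕ) (hN : N = Lc ^ (i + 1) * R)
    (κ' : Fin (d + 1)) (u' : Fin (d + 1) → ℤ) :
    e3OfS N (fun κ u => pushSum (Lc ^ (i + 1)) R (borderSum (Lc ^ i) (fun κ z => symVhSAt (toSite rr) d Lc rfl κ z) κ u)) κ' u'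
      = (((Lc : ℝ) ^ i) ^ (d + 2))⁻¹ •
          (push₃ (respStep (d := d) (Lc ^ i) N) (tentLeg Lc R N) (respStep (d := d) (Lc ^ i) N)
              (reslot Sum.inl Sum.inr fun κ u => symVhSAt (toSite rr) d Lc rfl κ u) κ' u'
            - push₃ (tentLeg Lc R N) (respStep (d := d) (Lc ^ i) N) (respStep (d := d) (Lc ^ i) N)
              (reslot Sum.inr Sum.inl fun κ u => symVhSAt (toSite rr) d Lc rfl κ u) κ' u') := by
  haveI : NeZero (Lc ^ i * (Lc * R)) := ⟨mul_ne_zero (pow_ne_zero _ (NeZero.ne Lc)) (mul_ne_zero (NeZero.ne Lc) (NeZero.ne R))⟩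
  have hR : 1 ≤ R := Nat.one_le_iff_ne_zero.2 (NeZero.ne R)
  have hN' : N = Lc ^ i * (Lc * R) := by rw [hN, pow_succ, mul_assoc]
  have hM : (((Lc : ℝ) ^ i) ^ (d + 2)) ≠ 0 := pow_ne_zero _ (pow_ne_zero _ (by exact_mod_cast NeZero.ne Lc))
  have hV := locStencil_symVhSAt (d := d) hLc hrr zero_le_one
  have hP := locStencil_pushSum (Lc := Lc) hV zero_le_one hR
  -- the e3OfS form of the pushed border row
  have e1 : e3OfS N (fun κ u => pushSum (Lc ^ (i + 1)) R (borderSum (Lc ^ i) (fun κ z => symVhSAt (toSite rr) d Lc rfl κ z) κ u)) κ' u'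
      = (((Lc : ℝ) ^ i) ^ (d + 2))⁻¹ • e3OfS N (fun κ u => ((((Lc ^ i : ℕ) : ℝ) ^ (d + 2))) •
          borderSum (Lc ^ i) (fun κ z => pushSum Lc R (symVhSAt (toSite rr) d Lc rfl κ z)) κ u) κ' u' := by
    rw [e3OfS_smul, smul_smul, Nat.cast_pow, inv_mul_cancel₀ hM, one_smul]
    congr 1
    funext κ u
    exact pushSum_borderSum _ i κ u
  rw [e1, ← mixed_push₃_eq_e3OfS_borderSum hN' hP one_pos
      (fun κ u x z α β => by simp only [pushSum_inl_inl, symVhSAt_inl_inl])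
      (fun κ u x z μ ν => pushSum_inr_inr_eq_zero_of (fun x z μ ν => symVhSAt_inr_inr _ _ _ _ _ _ _ _) x z μ ν) κ' u']
  obtain ⟨C', m', hm', hB⟩ := exists_legDecay_respStep (d := d) hN'
  have hBb : ∀ α x' κ x, |respStep (d := d) (Lc ^ i) N α x' κ x| ≤ C' := fun α x' κ x => hB.abs_le hm'.le α x' κ x
  rw [push₃_colM_pushSum hBb hB hm' hV one_pos hN' rfl κ' u', push₃_rowMM_pushSum hB hm' hV one_pos hN' rfl κ' u']

end Road

/-! ## §4 The identification -/

section Ident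

variable {Lc : ℕ} [NeZero Lc] {R N : ℕ} [NeZero R] [NeZero N]

/-- NOT IN PRINT; OUR BOOKKEEPING ((V-U) multi-level; [folklore]).  **THE UNDRESSED V LINEAGE OF THE COMB FAMILY IS `e3OfS` OF ROAD S3's SYMMETRIC-TABLE ROOTED PUSHED
BORDER ROW**: for `N = Lc^(i+1)·R`, in-block root `ρ = toSite rr`,
`push₃ B′ B′ B′ Y⁰_i κ′ u′ = e3OfS N (fun κ u ↦ (cVH·(smStep d Lc i)²·(Lc^i)^{d+2}) • pushSum (Lc^(i+1)) R (borderSum (Lc^i) (vhSAt ρ) κ u)) κ′ u′`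
— the object of p2's `TaylorRowVSymAn1At.rowV_three_at` (`R = Lc^(n+1)`, `N = Lc^(i+n+1+1)`) up to the displayed k∕i-bookkept scalar. -/
theorem lineage_v_eq_e3OfS_pushSum (hLc : 1 ≤ Lc) {rr : Fin (d + 1) → ℕ} (hrr : rr ∈ box (d + 1) Lc) (cVH : ℝ) (i : ℕ)
    (hN : N = Lc ^ (i + 1) * R) (κ' : Fin (d + 1)) (u' : Fin (d + 1) → ℤ) :
    push₃ (respStep (d := d) (Lc ^ (i + 1)) N) (respStep (d := d) (Lc ^ (i + 1)) N) (respStep (d := d) (Lc ^ (i + 1)) N)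
        (fun κ u => -(push₃ (-respStep (d := d) (Lc ^ i) (Lc ^ (i + 1))) (colM (KStepUnit (d := d) Lc i) Lc)
              (respStep (d := d) (Lc ^ i) (Lc ^ (i + 1))) (reslot Sum.inl Sum.inr fun κ u => cVH • symVhSAt (toSite rr) d Lc rfl κ u) κ u
          + push₃ (rowMM (KStepUnit (d := d) Lc i) Lc) (respStep (d := d) (Lc ^ i) (Lc ^ (i + 1)))
              (respStep (d := d) (Lc ^ i) (Lc ^ (i + 1))) (reslot Sum.inr Sum.inl fun κ u => cVH • symVhSAt (toSite rr) d Lc rfl κ u) κ u)) κ' u'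
      = e3OfS N (fun κ u => (cVH * (smStep d Lc i) ^ 2 * (((Lc : ℝ) ^ i) ^ (d + 2))) •
          pushSum (Lc ^ (i + 1)) R (borderSum (Lc ^ i) (fun κ z => symVhSAt (toSite rr) d Lc rfl κ z) κ u)) κ' u' := by
  have hM : (((Lc : ℝ) ^ i) ^ (d + 2)) ≠ 0 := pow_ne_zero _ (pow_ne_zero _ (by exact_mod_cast NeZero.ne Lc))
  rw [lineage_v_eq_tent_pair hLc hrr cVH i hN κ' u', e3OfS_smul, road_v_eq_tent_pair hLc hrr i hN κ' u', smul_smul,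
    mul_assoc, mul_inv_cancel₀ hM, mul_one]

/-- NOT IN PRINT; OUR BOOKKEEPING.  The same in lineage indexing `k = i+n+1+1`, `R = Lc^(n+1)`: the undressed V lineage from birth `i` read at level `k`. -/
theorem lineage_v_succ_eq_e3OfS_pushSum (hLc : 1 ≤ Lc) {rr : Fin (d + 1) → ℕ} (hrr : rr ∈ box (d + 1) Lc) (cVH : ℝ) (i n : ℕ)
    (κ' : Fin (d + 1)) (u' : Fin (d + 1) → ℤ) :
    push₃ (respStep (d := d) (Lc ^ (i + 1)) (Lc ^ (i + n + 1 + 1))) (respStep (d := d) (Lc ^ (i + 1)) (Lc ^ (i + n + 1 + 1)))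
        (respStep (d := d) (Lc ^ (i + 1)) (Lc ^ (i + n + 1 + 1)))
        (fun κ u => -(push₃ (-respStep (d := d) (Lc ^ i) (Lc ^ (i + 1))) (colM (KStepUnit (d := d) Lc i) Lc)
              (respStep (d := d) (Lc ^ i) (Lc ^ (i + 1))) (reslot Sum.inl Sum.inr fun κ u => cVH • symVhSAt (toSite rr) d Lc rfl κ u) κ u
          + push₃ (rowMM (KStepUnit (d := d) Lc i) Lc) (respStep (d := d) (Lc ^ i) (Lc ^ (i + 1)))
              (respStep (d := d) (Lc ^ i) (Lc ^ (i + 1))) (reslot Sum.inr Sum.inl fun κ u => cVH • symVhSAt (toSite rr) d Lc rfl κ u) κ u)) κ' u'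
      = e3OfS (Lc ^ (i + n + 1 + 1)) (fun κ u => (cVH * (smStep d Lc i) ^ 2 * (((Lc : ℝ) ^ i) ^ (d + 2))) •
          pushSum (Lc ^ (i + 1)) (Lc ^ (n + 1)) (borderSum (Lc ^ i) (fun κ z => symVhSAt (toSite rr) d Lc rfl κ z) κ u)) κ' u' :=
  lineage_v_eq_e3OfS_pushSum hLc hrr cVH i (by rw [← pow_add]; ring_nf) κ' u'

end Ident

end Summit.QuantumFields.BalabanUV.Beta.GAN24.BornBorderLiftChainAn1

end
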